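import Summits.ValiantsHypothesis.ValiantsHypothesis.Theorems.LacunarySymmetroidMatrixDescartesChainLadder
import Summits.ValiantsHypothesis.ValiantsHypothesis.Theorems.LacunarySymmetroidMatrixDescartesCensusM4K4C28

/-!
# `MatrixDescartes` census — the CHAIN-LADDER RAYS of the certified row `M4K4C28`: `ζ_sym(4, 3(j+1)+1+i) ≥ 28(j+1) + 4·i`

HONEST FRAMING.  Object-search cell `pub-symmetroid`, crux `Theses.LacunarySymmetroid.MatrixDescartes`
(stmt-ValiantsHypothesis-18050); seat val-sym-mdr-p1 (g8).  LOWER-bound rows in census (CONJECTURE-A) currency; nothing about the crux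
`MatrixDescartes` (upper bound at fat formats), `DoorA26` / `DoorA34`, or `VP ≠ VNP`.  No definitions.

The typer's kernel certificate `Census.M4K4C28` (`ζ_sym(4,4) ≥ 28`: closed form `Census.M4K4C28.eval_det` + sign alternation at 29 rational
points) is fed — with the SAME certificate data and tactic blocks, re-checked here once — to the CHAIN LADDER in certificate form
(`Chain.not_posRootLawAt_ladder_add_of_certificate`: chaining the certificate with its own `x ↦ 1/x` reversal `j` times multiplies the
alternation count by `j+1` at the price of `3` letters per copy, and each of `i` grafted letters buys `m = 4` more), giving the
two-parameter family `ray (j i) : ¬ PosRootLawAt 4 ((j+1)·3 + 1 + i) ((j+1)·28 + i·4 − 1)` and numeral instances.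
[folklore] (intermediate value theorem; certificate arithmetic by `norm_num`, heartbeat budget as in the source certificate file).
-/

-- `Summit.ValiantsHypothesis.ValiantsHypothesis.…` repeats a component by the D-0017 layout
-- (single-conjunct summit), which the `dupNamespace` linter flags; the name is mandated.
set_option linter.dupNamespace false

namespace Summit.ValiantsHypothesis.ValiantsHypothesis.Theorems.LacunarySymmetroidMatrixDescartes.Census.Chain.RayM4K4C28

open Summit.ValiantsHypothesis.ValiantsHypothesis.Theorems.MatrixDescartes.Negative (PosRootLawAt)
open scoped BigOperators Matrix

-- 29 + 28 exact evaluations of the certificate's closed form exceed the default heartbeat budget (as in `Census.M4K4C28`).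
set_option maxHeartbeats 40000000 in
set_option exponentiation.threshold 2556 in
/-- **The chain-ladder rays of `M4K4C28`**: for every `j, i`, `ζ_sym(4, 3(j+1)+1+i) ≥ 28(j+1) + 4i` —
`¬ PosRootLawAt 4 ((j+1)·3 + 1 + i) ((j+1)·28 + i·4 − 1)` (the certified `28`-alternation row laddered `j` times and grafted `i` times).
[folklore] -/
theorem ray (j i : ℕ) : ¬ PosRootLawAt 4 ((j + 1) * 3 + 1 + i) ((j + 1) * 28 + i * 4 - 1) :=
  Summit.ValiantsHypothesis.ValiantsHypothesis.Theorems.LacunarySymmetroidMatrixDescartes.Census.Chain.not_posRootLawAt_ladder_add_of_certificate (N := 28)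
    Summit.ValiantsHypothesis.ValiantsHypothesis.Theorems.LacunarySymmetroidMatrixDescartes.Census.M4K4C28.eval_det
    (by intro l; fin_cases l <;> (unfold Matrix.IsSymm; ext i j; fin_cases i <;> fin_cases j <;> rfl))
    (![1/64, 27/1024, 1/32, 11/256, 3/64, 1/16, 3/32, 1/8, 41/256, 21/128, 11/64, 3/16, 7/32, 1/4, 9/32, 5/16, 11/32, 3/8, 7/16, 15/32, 1/2, 9/16, 19/32, 39/64, 5/8, 81/128, 21/32, 3/4, 4] : Fin 29 → ℝ)
    (by
      refine Fin.strictMono_iff_lt_succ.2 fun j => ?_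
      fin_cases j <;> simp only [Fin.castSucc_mk, Fin.succ_mk] <;> norm_num)
    (by intro j; fin_cases j <;> norm_num)
    (by intro j; fin_cases j <;> simp only [Fin.castSucc_mk, Fin.succ_mk] <;> norm_num)
    (by norm_num) j i

/-- `ζ_sym(4,7) ≥ 56` (certificate `M4K4C28` laddered `1` time(s), grafted `0` time(s)). [folklore] -/
theorem row_4_7 : ¬ PosRootLawAt 4 7 55 := by
  have h := ray 1 0
  norm_num at h
  exact h

/-- `ζ_sym(4,8) ≥ 60` (certificate `M4K4C28` laddered `1` time(s), grafted `1` time(s)). [folklore] -/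
theorem row_4_8 : ¬ PosRootLawAt 4 8 59 := by
  have h := ray 1 1
  norm_num at h
  exact h

/-- `ζ_sym(4,9) ≥ 64` (certificate `M4K4C28` laddered `1` time(s), grafted `2` time(s)). [folklore] -/
theorem row_4_9 : ¬ PosRootLawAt 4 9 63 := by
  have h := ray 1 2
  norm_num at h
  exact h

/-- `ζ_sym(4,10) ≥ 84` (certificate `M4K4C28` laddered `2` time(s), grafted `0` time(s)). [folklore] -/
theorem row_4_10 : ¬ PosRootLawAt 4 10 83 := by
  have h := ray 2 0
  norm_num at h
  exact h

/-- `ζ_sym(4,13) ≥ 112` (certificate `M4K4C28` laddered `3` time(s), grafted `0` time(s)). [folklore] -/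
theorem row_4_13 : ¬ PosRootLawAt 4 13 111 := by
  have h := ray 3 0
  norm_num at h
  exact h

/-- `ζ_sym(4,16) ≥ 140` (certificate `M4K4C28` laddered `4` time(s), grafted `0` time(s)). [folklore] -/
theorem row_4_16 : ¬ PosRootLawAt 4 16 139 := by
  have h := ray 4 0
  norm_num at h
  exact h

end Summit.ValiantsHypothesis.ValiantsHypothesis.Theorems.LacunarySymmetroidMatrixDescartes.Census.Chain.RayM4K4C28
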